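import Literature.NumberTheory.EllipticCurves.MazurTorsionStepOneAtNProofs
import Literature.NumberTheory.EllipticCurves.BinaryQuarticGoodReductionSolubilityProofs
import Literature.NumberTheory.EllipticCurves.VariableChangePoints
import HarnessLib

/-!
# A `3`-torsion point on the RAMIFIED quadratic twist `Y² = X³ − 3B₂X² + 9B₄X − 27B₆` of a curve
# good at `3` pins the residue `B₂ ≡ 1 (mod 3)` (local theorems over `ℚ₃`)

HONEST FRAMING (cell `b2b-bsdres`, run/shared/lean/b2b/bsd-rank1-residual/, verbatim in every
file): the goal of the cell is to DELETE the COMBINATION-SHAPED residual classes of the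
Birch–Swinnerton-Dyer formula for ALL analytic-rank `≤ 1` elliptic curves over `ℚ` — "full BSD
formula for every rank `≤ 1` curve in class `C`" assembled STRICTLY from published theorems — so
that the rank-`≤ 1` remainder becomes exactly the CONSTRUCTION-SHAPED classes, which are TYPED
(missing-input `Prop`s), NOT attempted. This is not "finishing BSD". Sub-cell `additive-p2`
(X3♯(G-ord) / X4♯(G-ord)), generation 39: research route; no claim beyond the stated classes;
TOOL theorems on local points only, no definition, no named fact, nothing booked, no label moved.

## What and why

Generations 37–38 settled the torsion term at an additive `p ≥ 5` (`Additive/LocalTorsionAdditive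
FiveSeven`, `Additive/LocalTorsionAnomalousResidue`): a `p`-torsion point in `E(ℚ_p)` forces
`c₄ ≡ −5 (mod 25)` / `c₆ ≡ 7 (mod 49)`, which on the (G)-cell is the ANOMALOUS residue.  At `p = 3`
the short model `y² = x³ + ax + b` with `a, b ∈ 3ℤ₃` is not available (the cube cannot be
completed `3`-integrally), and rational `3`-torsion is frequent on the (G)-cell (census: 214 of the
421 (G-ord) classes at `3` carry a `3`-torsion member).  Generation 38 recorded the elementary route
(ENDSTATE §4 [gen 38] (θ)); this file proves it.  On the (G)-cell at `3` every pair is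
`E = V^{(−3)}` with `V` good at `3` (Kodaira `I₀*`, `e = 2`; `Additive/TypeGThree`), and a
`3`-integral model of `E` with the cusp at the origin is

  `T : Y² = X³ − 3B₂X² + 9B₄X − 27B₆`,  `(B₂, B₄, B₆) = (b₂, 8b₄, 16b₆)(V)`,

the twist by `−3` of `y² = g(x) = x³ + B₂x² + B₄x + B₆ ≅ V` (`X = −3x`, `Y = 9y`).  Its `3`-division
polynomial is `ψ₃ = 3X⁴ − 12B₂X³ + 54B₄X² − 324B₆X + 81(4B₂B₆ − B₄²)`.  For a point `P = (X₀, Y₀)`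
of `T(ℚ₃)` with `3 • P = O`:

* `X₀ ∈ ℤ₃` (`E₁(ℚ₃)[3] = 0`, tree `not_prime_zsmul_eq_zero_of_one_lt_norm`, `3 ≤ p`);
* `3 ∤ X₀`: if `X₀ = 3x₁` then `Y₀² = 27·h(x₁)`, `h = x₁³ − B₂x₁² + B₄x₁ − B₆ = −g(−x₁)`, forces
  `3 ∣ h(x₁)`, and `ψ₃(3x₁) = 81·k(x₁)`, `k = ψ₃^{g}(−x₁)`, forces `k(x₁) = 0`; so `−x̄₁` is a
  common root of `ḡ` and `ψ̄₃^{g}` over `𝔽₃` — a point of `ȳ² = ḡ` killed by `2` and by `3` —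
  which forces `disc(ḡ) = 0` (`zmod_three_disc_eq_zero_of_common_root`, `decide` over `𝔽₃⁴`),
  contradicting good reduction of `V` (`disc(g) = 256·Δ(V)`);
* so `X₀ ∈ ℤ₃ˣ`, and then `ψ₃(X₀)/3 ≡ X₀³(X₀ − 4B₂) (mod 3)` gives `X₀ ≡ B₂ (mod 3)`, while the
  ORDINATE gives `Y₀² ≡ X₀³ (mod 3)`, so `X₀` is a non-zero square mod `3`, i.e. `X₀ ≡ 1`:
  **`B₂ ≡ 1 (mod 3)`** (`three_dvd_sub_one_of_torsionEquations`; in particular `B₂ ∈ ℤ₃ˣ`: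
  `V` is ORDINARY at `3`, and — `Additive/AnomalousPointCountThree` — `a₃(V) ≡ b₂(V) ≡ 1 (mod 3)`:
  `V` is ANOMALOUS at `3`).

Main statements: `three_dvd_sub_one_of_three_zsmul_eq_zero` (a point `P ≠ O` of `T(ℚ₃)` with
`3 • P = O` forces `3 ∣ B₂ − 1`, for any `T/ℤ₃` with `(a₁, a₂, a₃, a₄, a₆) = (0, −3B₂, 0, 9B₄, −27B₆)`
and `3 ∤ disc(B₂, B₄, B₆)`) and its transport `…_of_variableChange` along a `ℚ₃`-isomorphism
`D • T_{ℚ₃} = X` (the form consumed by `Additive/GordTorsionAnomalousThree`, where `X = E_{ℚ₃}`).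

References: [Mazur1977] B. Mazur, Publ. Math. IHÉS 47 (1977), Ch. III §5, Step 1, p. 158 (the
method at `q = N`); [SilvermanAEC2009] J. H. Silverman, *AEC* 2nd ed., VII.3.1, IV.6.1 (`E₁` is
torsion-free for `e < p − 1`), Exercise 3.7 (division polynomials), X.5.4 (twists); M. Flexor,
J. Oesterlé, Astérisque 183 (1990) 25–36 (torsion vs. additive reduction — context).
-/

noncomputable section

open scoped Classical

namespace Summit.BirchSwinnertonDyer.Rank1Residual.Additive.TorsionThree

open WeierstrassCurve Polynomial Literature.NumberTheory.EllipticCurves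

/-! ## §1 Two finite checks over `𝔽₃` -/

/-- In `𝔽₃`: `x ≠ 0`, `y² = x³`, `x⁴ = 4·b·x³` ⟹ `b = 1` (`x` is a non-zero square, so `x = 1`,
and `x = 4b = b`). [folklore] -/
theorem zmod_three_eq_one_of_sq_eq_cube_of_quartic :
    ∀ b x y : ZMod 3, x ≠ 0 → y ^ 2 - x ^ 3 = 0 → x ^ 4 - 4 * b * x ^ 3 = 0 → b = 1 := by
  decide

/-- In `𝔽₃`: a common root `x` of `X³ − b₂X² + b₄X − b₆` (i.e. `−x` is a root of
`g = X³ + b₂X² + b₄X + b₆`) and of `−4b₂X³ + (4b₂b₆ − b₄²)` (`ψ₃^{g}(−X)` reduced mod `3`) forces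
`disc(g) ≡ b₂²b₄² − 4b₄³ − 4b₂³b₆ = 0` — a point `(−x, 0)` of `y² = g` killed by `2` and by `3` makes
the cubic singular. [folklore] -/
theorem zmod_three_disc_eq_zero_of_common_root :
    ∀ b₂ b₄ b₆ x : ZMod 3, x ^ 3 - b₂ * x ^ 2 + b₄ * x - b₆ = 0 →
      -(4 * b₂ * x ^ 3) + (4 * b₂ * b₆ - b₄ ^ 2) = 0 →
        b₂ ^ 2 * b₄ ^ 2 - 4 * b₄ ^ 3 - 4 * b₂ ^ 3 * b₆ = 0 := by
  decide

/-! ## §2 The `3`-adic core: the two equations of a `3`-torsion point pin `B₂ ≡ 1 (mod 3)` -/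

/-- `3 ∣ z` in `ℤ₃` iff `z̄ = 0` in `𝔽₃` (the tree's `toZMod_eq_zero_iff` at `p = 3`). [folklore] -/
theorem toZMod_eq_zero_iff_three_dvd [Fact (Nat.Prime 3)] (z : ℤ_[3]) :
    PadicInt.toZMod z = 0 ↔ (3 : ℤ_[3]) ∣ z := by
  simpa using BinaryQuartic.toZMod_eq_zero_iff (p := 3) z

/-- **The `3`-adic core.** In `ℤ₃`, if `Y₀² = X₀³ − 3B₂X₀² + 9B₄X₀ − 27B₆` (the point lies on the
twisted model `T`), `ψ₃^{T}(X₀) = 3X₀⁴ − 12B₂X₀³ + 54B₄X₀² − 324B₆X₀ + 81(4B₂B₆ − B₄²) = 0` (it is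
killed by `3`) and `3 ∤ disc(B₂, B₄, B₆)` (the cubic `x³ + B₂x² + B₄x + B₆` is smooth mod `3`), then
**`3 ∣ B₂ − 1`**: `3 ∣ X₀` is impossible (common root of `ḡ` and `ψ̄₃^{g}`), and for a unit `X₀`
the two equations read `X₀ ≡ 4B₂`, `Y₀² ≡ X₀³ (mod 3)`.
[cite: Mazur1977, Ch. III §5, Step 1, p. 158 (method); SilvermanAEC2009, Exercise 3.7(d),(f) (PDF pp. 97–98)] -/
theorem three_dvd_sub_one_of_torsionEquations [Fact (Nat.Prime 3)] {B₂ B₄ B₆ x₀ y₀ : ℤ_[3]}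
    (hE : y₀ ^ 2 = x₀ ^ 3 - 3 * B₂ * x₀ ^ 2 + 9 * B₄ * x₀ - 27 * B₆)
    (hΨ : 3 * x₀ ^ 4 - 12 * B₂ * x₀ ^ 3 + 54 * B₄ * x₀ ^ 2 - 324 * B₆ * x₀ +
      81 * (4 * B₂ * B₆ - B₄ ^ 2) = 0)
    (hΔ : ¬ (3 : ℤ_[3]) ∣ B₂ ^ 2 * B₄ ^ 2 - 4 * B₄ ^ 3 - 4 * B₂ ^ 3 * B₆ - 27 * B₆ ^ 2 +
      18 * B₂ * B₄ * B₆) :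
    (3 : ℤ_[3]) ∣ B₂ - 1 := by
  have h3 : Prime (3 : ℤ_[3]) := by simpa using (PadicInt.prime_p (p := 3))
  have h30 : (3 : ℤ_[3]) ≠ 0 := h3.ne_zero
  set φ : ℤ_[3] →+* ZMod 3 := PadicInt.toZMod with hφ
  have hker : ∀ z : ℤ_[3], φ z = 0 ↔ (3 : ℤ_[3]) ∣ z := toZMod_eq_zero_iff_three_dvd
  have hφ3 : ∀ z : ℤ_[3], φ (3 * z) = 0 := fun z => (hker _).mpr (dvd_mul_right 3 z)
  by_cases hx : (3 : ℤ_[3]) ∣ x₀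
  · -- `X₀ = 3x₁`: a common root of `ḡ` and `ψ̄₃^{g}` over `𝔽₃`, impossible on the good fibre
    exfalso
    obtain ⟨x₁, rfl⟩ := hx
    -- `ψ₃(3x₁) = 81·k(x₁)`, so `k(x₁) = 0`
    have hk : 3 * x₁ ^ 4 - 4 * B₂ * x₁ ^ 3 + 6 * B₄ * x₁ ^ 2 - 12 * B₆ * x₁ +
        (4 * B₂ * B₆ - B₄ ^ 2) = 0 := by
      have e : 3 * (3 * x₁) ^ 4 - 12 * B₂ * (3 * x₁) ^ 3 + 54 * B₄ * (3 * x₁) ^ 2 -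
          324 * B₆ * (3 * x₁) + 81 * (4 * B₂ * B₆ - B₄ ^ 2) =
          81 * (3 * x₁ ^ 4 - 4 * B₂ * x₁ ^ 3 + 6 * B₄ * x₁ ^ 2 - 12 * B₆ * x₁ +
            (4 * B₂ * B₆ - B₄ ^ 2)) := by ring
      rw [e] at hΨ
      exact (mul_eq_zero.mp hΨ).resolve_left (by norm_num)
    -- `Y₀² = 27·h(x₁)`, so `3 ∣ h(x₁)`
    have hy : y₀ ^ 2 = 27 * (x₁ ^ 3 - B₂ * x₁ ^ 2 + B₄ * x₁ - B₆) := by rw [hE]; ring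
    have h3h : (3 : ℤ_[3]) ∣ x₁ ^ 3 - B₂ * x₁ ^ 2 + B₄ * x₁ - B₆ := by
      have h3y : (3 : ℤ_[3]) ∣ y₀ :=
        h3.dvd_of_dvd_pow (n := 2) ⟨9 * (x₁ ^ 3 - B₂ * x₁ ^ 2 + B₄ * x₁ - B₆), by rw [hy]; ring⟩
      obtain ⟨y₁, rfl⟩ := h3y
      have hy₁ : y₁ ^ 2 = 3 * (x₁ ^ 3 - B₂ * x₁ ^ 2 + B₄ * x₁ - B₆) := by
        have e : (3 : ℤ_[3]) ^ 2 * y₁ ^ 2 =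
            (3 : ℤ_[3]) ^ 2 * (3 * (x₁ ^ 3 - B₂ * x₁ ^ 2 + B₄ * x₁ - B₆)) := by
          linear_combination hy
        exact mul_left_cancel₀ (pow_ne_zero 2 h30) e
      have h3y₁ : (3 : ℤ_[3]) ∣ y₁ :=
        h3.dvd_of_dvd_pow (n := 2) ⟨x₁ ^ 3 - B₂ * x₁ ^ 2 + B₄ * x₁ - B₆, by rw [hy₁]⟩
      obtain ⟨y₂, rfl⟩ := h3y₁
      refine ⟨y₂ ^ 2, mul_left_cancel₀ h30 ?_⟩
      linear_combination -hy₁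
    -- reduce both mod `3`
    have e1 : φ x₁ ^ 3 - φ B₂ * φ x₁ ^ 2 + φ B₄ * φ x₁ - φ B₆ = 0 := by
      have h0 := (hker _).mpr h3h
      simpa only [map_sub, map_add, map_mul, map_pow] using h0
    have e2 : -(4 * φ B₂ * φ x₁ ^ 3) + (4 * φ B₂ * φ B₆ - φ B₄ ^ 2) = 0 := by
      have hsplit : -(4 * B₂ * x₁ ^ 3) + (4 * B₂ * B₆ - B₄ ^ 2) =
          3 * (-(x₁ ^ 4) - 2 * B₄ * x₁ ^ 2 + 4 * B₆ * x₁) := by linear_combination hk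
      have h0 : φ (-(4 * B₂ * x₁ ^ 3) + (4 * B₂ * B₆ - B₄ ^ 2)) = 0 := by rw [hsplit]; exact hφ3 _
      simpa only [map_sub, map_add, map_mul, map_pow, map_neg, map_ofNat] using h0
    have key := zmod_three_disc_eq_zero_of_common_root (φ B₂) (φ B₄) (φ B₆) (φ x₁) e1 e2
    apply hΔ
    have hsplit : B₂ ^ 2 * B₄ ^ 2 - 4 * B₄ ^ 3 - 4 * B₂ ^ 3 * B₆ - 27 * B₆ ^ 2 +
        18 * B₂ * B₄ * B₆ =
        (B₂ ^ 2 * B₄ ^ 2 - 4 * B₄ ^ 3 - 4 * B₂ ^ 3 * B₆) + 3 * (-(9 * B₆ ^ 2) + 6 * B₂ * B₄ * B₆) := by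
      ring
    rw [hsplit]
    refine dvd_add ((hker _).mp ?_) (dvd_mul_right 3 _)
    simpa only [map_sub, map_add, map_mul, map_pow, map_ofNat] using key
  · -- `X₀ ∈ ℤ₃ˣ`: `ψ₃(X₀)/3 ≡ X₀³(X₀ − 4B₂)` and `Y₀² ≡ X₀³ (mod 3)`
    have hx' : φ x₀ ≠ 0 := fun h0 => hx ((hker x₀).mp h0)
    have hq : x₀ ^ 4 - 4 * B₂ * x₀ ^ 3 + 18 * B₄ * x₀ ^ 2 - 108 * B₆ * x₀ +
        27 * (4 * B₂ * B₆ - B₄ ^ 2) = 0 := by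
      have e : 3 * x₀ ^ 4 - 12 * B₂ * x₀ ^ 3 + 54 * B₄ * x₀ ^ 2 - 324 * B₆ * x₀ +
          81 * (4 * B₂ * B₆ - B₄ ^ 2) =
          3 * (x₀ ^ 4 - 4 * B₂ * x₀ ^ 3 + 18 * B₄ * x₀ ^ 2 - 108 * B₆ * x₀ +
            27 * (4 * B₂ * B₆ - B₄ ^ 2)) := by ring
      rw [e] at hΨ
      exact (mul_eq_zero.mp hΨ).resolve_left h30
    have eΨ : φ x₀ ^ 4 - 4 * φ B₂ * φ x₀ ^ 3 = 0 := by
      have hsplit : x₀ ^ 4 - 4 * B₂ * x₀ ^ 3 =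
          3 * (-(6 * B₄ * x₀ ^ 2) + 36 * B₆ * x₀ - 9 * (4 * B₂ * B₆ - B₄ ^ 2)) := by
        linear_combination hq
      have h0 : φ (x₀ ^ 4 - 4 * B₂ * x₀ ^ 3) = 0 := by rw [hsplit]; exact hφ3 _
      simpa only [map_sub, map_mul, map_pow, map_ofNat] using h0
    have eE : φ y₀ ^ 2 - φ x₀ ^ 3 = 0 := by
      have hsplit : y₀ ^ 2 - x₀ ^ 3 = 3 * (-(B₂ * x₀ ^ 2) + 3 * B₄ * x₀ - 9 * B₆) := by
        linear_combination hE
      have h0 : φ (y₀ ^ 2 - x₀ ^ 3) = 0 := by rw [hsplit]; exact hφ3 _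
      simpa only [map_sub, map_pow] using h0
    have key := zmod_three_eq_one_of_sq_eq_cube_of_quartic (φ B₂) (φ x₀) (φ y₀) hx' eE eΨ
    refine (hker _).mp ?_
    rw [map_sub, map_one, key, sub_self]

/-! ## §3 On the curve: a `ℚ₃`-point `P ≠ O` of `T` with `3 • P = O` -/

/-- **A `3`-torsion point on `T : Y² = X³ − 3B₂X² + 9B₄X − 27B₆` over `ℚ₃` (`Bᵢ ∈ ℤ₃`,
`3 ∤ disc(B₂, B₄, B₆)`) forces `3 ∣ B₂ − 1`.** The abscissa is `3`-integral by `E₁(ℚ₃)[3] = 0`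
(tree `not_prime_zsmul_eq_zero_of_one_lt_norm`, valid at `p = 3`), the ordinate by integrality of
the equation; `3 • P = O` gives `ψ₃(X₀) = 0` (`ψ₃² = ΨSq₃` on the curve, Mathlib's `Ψ₃`); then
`three_dvd_sub_one_of_torsionEquations`.
[cite: Mazur1977, Ch. III §5, Step 1, p. 158 (method); SilvermanAEC2009, VII.3 Prop. 3.1 with IV.6 Thm. 6.1, and Exercise 3.7(d),(f)] -/
theorem three_dvd_sub_one_of_three_zsmul_eq_zero [Fact (Nat.Prime 3)] (T : WeierstrassCurve ℤ_[3])
    {B₂ B₄ B₆ : ℤ_[3]} (ha₁ : T.a₁ = 0) (ha₂ : T.a₂ = -(3 * B₂)) (ha₃ : T.a₃ = 0)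
    (ha₄ : T.a₄ = 9 * B₄) (ha₆ : T.a₆ = -(27 * B₆)) [(T.baseChange ℚ_[3]).IsElliptic]
    (hΔ : ¬ (3 : ℤ_[3]) ∣ B₂ ^ 2 * B₄ ^ 2 - 4 * B₄ ^ 3 - 4 * B₂ ^ 3 * B₆ - 27 * B₆ ^ 2 +
      18 * B₂ * B₄ * B₆)
    {P : (T.baseChange ℚ_[3]).toAffine.Point} (hP0 : P ≠ 0) (hP : (3 : ℤ) • P = 0) :
    (3 : ℤ_[3]) ∣ B₂ - 1 := by
  rcases P with _ | ⟨x, y, h⟩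
  · exact absurd rfl hP0
  · -- `X₀ ∈ ℤ₃`
    have hx : ‖x‖ ≤ 1 := by
      by_contra hx1
      exact not_prime_zsmul_eq_zero_of_one_lt_norm (p := 3) le_rfl T h (not_le.mp hx1)
        (by exact_mod_cast hP)
    have hy : ‖y‖ ≤ 1 := norm_y_le_one' T h.1 hx
    obtain ⟨x₀, rfl⟩ : ∃ x₀ : ℤ_[3], algebraMap ℤ_[3] ℚ_[3] x₀ = x := ⟨⟨x, hx⟩, rfl⟩
    obtain ⟨y₀, rfl⟩ : ∃ y₀ : ℤ_[3], algebraMap ℤ_[3] ℚ_[3] y₀ = y := ⟨⟨y, hy⟩, rfl⟩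
    -- the equation in `ℤ₃`
    have h1 : algebraMap ℤ_[3] ℚ_[3] y₀ ^ 2 +
        algebraMap ℤ_[3] ℚ_[3] T.a₁ * algebraMap ℤ_[3] ℚ_[3] x₀ * algebraMap ℤ_[3] ℚ_[3] y₀ +
        algebraMap ℤ_[3] ℚ_[3] T.a₃ * algebraMap ℤ_[3] ℚ_[3] y₀ =
        algebraMap ℤ_[3] ℚ_[3] x₀ ^ 3 +
        algebraMap ℤ_[3] ℚ_[3] T.a₂ * algebraMap ℤ_[3] ℚ_[3] x₀ ^ 2 +
        algebraMap ℤ_[3] ℚ_[3] T.a₄ * algebraMap ℤ_[3] ℚ_[3] x₀ + algebraMap ℤ_[3] ℚ_[3] T.a₆ :=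
      (Affine.equation_iff _ _).mp h.1
    have h2 : y₀ ^ 2 + T.a₁ * x₀ * y₀ + T.a₃ * y₀ = x₀ ^ 3 + T.a₂ * x₀ ^ 2 + T.a₄ * x₀ + T.a₆ := by
      apply IsFractionRing.injective ℤ_[3] ℚ_[3]
      simp only [map_pow, map_add, map_mul]
      exact h1
    have hE : y₀ ^ 2 = x₀ ^ 3 - 3 * B₂ * x₀ ^ 2 + 9 * B₄ * x₀ - 27 * B₆ := by
      rw [ha₁, ha₂, ha₃, ha₄, ha₆] at h2
      linear_combination h2
    -- `ψ₃(X₀) = 0` in `ℤ₃`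
    have hΨ' : T.Ψ₃.eval x₀ = 0 := by
      have hodd : ¬ Even 3 := by decide
      have h0 := hP
      rw [zsmul_eq_zero_iff_evalEval_ψ_holds (T.baseChange ℚ_[3]) (3 : ℤ) h] at h0
      have h3 := evalEval_ψ_sq (T.baseChange ℚ_[3]) h.1 (3 : ℤ)
      have h4 : (T.baseChange ℚ_[3]).ΨSq (3 : ℤ) = (T.baseChange ℚ_[3]).Ψ₃ ^ 2 := by
        have h5 := ΨSq_ofNat (W := T.baseChange ℚ_[3]) 3
        rw [if_neg hodd, mul_one, preΨ'_three] at h5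
        exact_mod_cast h5
      rw [h0, zero_pow two_ne_zero, h4, eval_pow, eq_comm, pow_eq_zero_iff two_ne_zero,
        show (T.baseChange ℚ_[3]).Ψ₃ = T.Ψ₃.map (algebraMap ℤ_[3] ℚ_[3]) from
          map_Ψ₃ T (algebraMap ℤ_[3] ℚ_[3]),
        eval_map, eval₂_at_apply, map_eq_zero_iff _ (IsFractionRing.injective ℤ_[3] ℚ_[3])] at h3
      exact h3
    have hΨ : 3 * x₀ ^ 4 - 12 * B₂ * x₀ ^ 3 + 54 * B₄ * x₀ ^ 2 - 324 * B₆ * x₀ +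
        81 * (4 * B₂ * B₆ - B₄ ^ 2) = 0 := by
      rw [← hΨ', Ψ₃]
      simp only [eval_add, eval_mul, eval_pow, eval_C, eval_X, eval_ofNat, b₂, b₄, b₆, b₈, ha₁, ha₂,
        ha₃, ha₄, ha₆]
      ring
    exact three_dvd_sub_one_of_torsionEquations hE hΨ hΔ

/-- **Transport along a `ℚ₃`-isomorphism.** If `D • T_{ℚ₃} = X` for a change of variables `D`
over `ℚ₃` (`T` as in `three_dvd_sub_one_of_three_zsmul_eq_zero`), then a point `P ≠ O` of `X(ℚ₃)`
with `3 • P = O` forces `3 ∣ B₂ − 1` (the tree's `VariableChange.pointEquiv` is a group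
isomorphism). This is the form consumed with `X = E_{ℚ₃}` for a (G)-pair `(E, 3)`.
[cite: Mazur1977, Ch. III §5, Step 1, p. 158 (method); SilvermanAEC2009, III.3.1(b), Exercise 3.7(d),(f)] -/
theorem three_dvd_sub_one_of_three_zsmul_eq_zero_of_variableChange [Fact (Nat.Prime 3)]
    (T : WeierstrassCurve ℤ_[3]) {B₂ B₄ B₆ : ℤ_[3]} (ha₁ : T.a₁ = 0) (ha₂ : T.a₂ = -(3 * B₂))
    (ha₃ : T.a₃ = 0) (ha₄ : T.a₄ = 9 * B₄) (ha₆ : T.a₆ = -(27 * B₆))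
    (hΔ : ¬ (3 : ℤ_[3]) ∣ B₂ ^ 2 * B₄ ^ 2 - 4 * B₄ ^ 3 - 4 * B₂ ^ 3 * B₆ - 27 * B₆ ^ 2 +
      18 * B₂ * B₄ * B₆)
    {X : WeierstrassCurve ℚ_[3]} [X.IsElliptic] (D : VariableChange ℚ_[3])
    (hX : D • T.baseChange ℚ_[3] = X)
    {P : X.toAffine.Point} (hP0 : P ≠ 0) (hP : (3 : ℤ) • P = 0) :
    (3 : ℤ_[3]) ∣ B₂ - 1 := by
  subst hX
  haveI : (T.baseChange ℚ_[3]).IsElliptic := by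
    have h : (D⁻¹ • (D • T.baseChange ℚ_[3])).IsElliptic := inferInstance
    rwa [smul_smul, inv_mul_cancel, one_smul] at h
  set Q := (VariableChange.pointEquiv (T.baseChange ℚ_[3]) D).symm P with hQ
  have hQ0 : Q ≠ 0 := by
    intro h0
    apply hP0
    have h1 : P = VariableChange.pointEquiv (T.baseChange ℚ_[3]) D Q :=
      (AddEquiv.apply_symm_apply _ P).symm
    rw [h1, h0, map_zero]
  have hQ3 : (3 : ℤ) • Q = 0 := by
    rw [hQ, ← map_zsmul, hP, map_zero]
  exact three_dvd_sub_one_of_three_zsmul_eq_zero T ha₁ ha₂ ha₃ ha₄ ha₆ hΔ hQ0 hQ3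

end Summit.BirchSwinnertonDyer.Rank1Residual.Additive.TorsionThree

end
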